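import Mathlib.Geometry.Manifold.Instances.Sphere
import Literature.Geometry.Lorentzian.TrappedSurface
import Literature.Geometry.Lorentzian.RedShiftedCollar
import Literature.Geometry.Lorentzian.QuasiFinalStateDecomposition
import Literature.Geometry.Lorentzian.ShellDeviation
import Literature.Geometry.Lorentzian.CauchyDevelopment
import Literature.Geometry.Lorentzian.NullInfinity
import Literature.Geometry.Lorentzian.KerrTimelikeSpan
import HarnessLib

/-!
# `C²_loc` (horizon-excised) settling to Kerr, and red-shifted collars at `C⁴`/`C³` regularity

Topic `Geometry/Lorentzian`, next to `QuasiFinalStateDecomposition`, `ShellDeviation` and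
`RedShiftedCollar`. Vocabulary requested by the crux-strategist of route
`FinalStateConjecture/SpectralSurfaceGravity` (crux `GenericRedShiftedSettling`,
stmt-FinalStateConjecture-17368) for the typed decomposition of that crux; everything is a definition over
existing declarations or an elementary proved lemma — NO facts (`def … : Prop` hypotheses about any
development) are introduced.

The printed final-state picture (Dafermos–Luk, arXiv:1710.01722, §1.2.1 and Conjecture 1 (b)–(c): "the
geometry remains close to `g_{a₀,M₀}` in `J⁻(𝓘⁺)`", approach to a nearby Kerr "at an inverse polynomial
rate") is rendered in the tree by `FinalStateDecomposition 𝓢 𝒟 k` (`KerrConvergence`): `Cᵏ` convergence of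
the hole charts to boosted Kerr on the truncated slabs `{t*ᵢ = τ, rᵢ ≤ R}` of the OPEN exteriors
`{rᵢ > r₊}` — uniformly up to the horizon. The stability theorems conclude in two regimes which this
uniformity conflates: on compacta of the exterior / away from the horizon (Dafermos–Holzegel–Rodnianski–
Taylor arXiv:2104.08222, §1: decay measured on `{r ≤ R}`; Klainerman–Szeftel, AMS-210 (2020), §1.2) and
ACROSS the horizon, where sub-extremality enters through the red-shift (Dafermos–Rodnianski,
arXiv:0811.0354, §3.3 and §7.1, Thm. 7.1: the construction "depends only on the positivity of the surface
gravity") and where, at extremality, transversal derivatives do not decay (Aretakis). This file names the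
first regime on its own.

## Contents (namespace `Literature.Geometry.Lorentzian`)

* `Spacetime.annularDeviationCk 𝓢 B Ψ k ρ₁ ρ₂ τ` — the UNWEIGHTED `Cᵏ` sup deviation
  `sup_{m ≤ k} sup_{t = τ, ρ₁ ≤ r ≤ ρ₂} ‖Dᵐ(Ψ^* g − g_B)‖` of a chart from its model background on the chart
  shell `ModelBackground.shellTimeSlab B ρ₁ ρ₂ τ` (`supCkENorm` of `Spacetime.deviationExtend`; the
  scale-weighted variant is `Spacetime.shellDeviationCk` of `ShellDeviation`). With `ρ₁ = r₊ + δ`, `δ > 0`,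
  it measures closeness to Kerr on a compactum of the open exterior.
* the elementary seam lemmas `supCkENorm_union_le`,
  `ModelBackground.truncTimeSlab_subset_truncTimeSlab_union_shellTimeSlab` (`{r ≤ R} ⊆ {r ≤ ρ} ∪ {ρ ≤ r ≤ R}`),
  `Spacetime.annularDeviationCk_le_truncDeviationCk`, `Spacetime.truncDeviationCk_le_max` (near-zone
  deviation `≤ max`(inner truncated part, outer shell)), and the two `Tendsto` forms
  `Spacetime.tendsto_annularDeviationCk_of_tendsto_truncDeviationCk` (forgetful) and
  `Spacetime.tendsto_truncDeviationCk_of_inner_of_annular` (gluing limits across a radius `ρ`, radii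
  `R τ` possibly growing).
* `QuasiFinalStateDecomposition.IsFutureOrientedCharts q` — verbatim the body of the Summit-side
  `Summit.FinalStateConjecture.IsFutureOriented` (which Literature may not import) read in the charts of a
  quasi decomposition `q`: orthochronous motions `(Λᵢ e₀)⁰ > 0`; the push-forwards of the boosted
  backgrounds' future timelike fields `Λᵢ V_{Mᵢ,aᵢ}` (`Kerr.timeVector`) eventually future-directed on every
  truncated slab; the push-forward of `∂₀` eventually future-directed on the flat slabs.
* `QuasiFinalStateDecomposition.HasLocExhaustiveCharts q` — the Summit-side `HasExhaustiveCharts`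
  (honest growing radii `Rᵢ(τ) ≥ max(r₊,0) + 1`, `Rᵢ → ∞`; causal covering of `𝒟` outside the certified
  late region by the certified slab for every chart time `τ₁ > τ₀`, over the Literature copies
  `certifiedLate` / `certifiedSlab`) with the growing-radii convergence clause EXCISED away from the horizon:
  `annularDeviationCk … (r₊ᵢ + δ) (Rᵢ τ) τ → 0` for every `δ > 0`.
* `CauchyDevelopment.IsLocSettling 𝒟 O q` — "settles down in `C²_loc`" for ONE Cauchy development:
  `q : QuasiFinalStateDecomposition 𝒟.toSpacetime O 2 ⊤` (the chart GEOMETRY of a final-state decomposition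
  — finitely many boosted Kerr exteriors `|aᵢ| ≤ Mᵢ`, late charts into `O`, separation, sublinear excision,
  flat chart, covering; the closeness clauses are vacuous at `ε = ⊤`) with: (i) `C²` shell deviations
  `→ 0` on `{t*ᵢ = τ, r₊ᵢ + δ ≤ rᵢ ≤ R}` for every hole, `δ > 0`, `R`; (ii) `C²` flat deviation `→ 0`;
  (iii) `O = J⁺(ιX) ∩ I⁻(q.charted)` (verbatim the body of `Summit.FinalStateConjecture.exteriorOf`);
  (iv) every future-complete normalised null ray from the data stays in `closure O` (verbatim the body of
  `Summit.FinalStateConjecture.RaysStayInClosure`); (v) `HasLocExhaustiveCharts q`;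
  (vi) `IsFutureOrientedCharts q`. Nothing is asserted at or across the horizons.
* `CauchyDevelopment.isLocSettling_toQuasi` — the forgetful direction: a `C²` final-state decomposition with
  the Statement's clauses (stated through the unfolded bodies) is a `C²_loc` settling in its own charts.
* `Spacetime.RedShiftedCollarC4 𝓢 Λ c M a τ₀ chart` — VERBATIM the `let`-bound block `RSC` of the route items
  `HorizonSubextremal` (stmt-FinalStateConjecture-17367) / `GenericRedShiftedSettling` (stmt-17368) at their
  CURRENT regularity (rev 4, refuter repair 2026-08-15/16: `C⁴` collar chart `Φ`, jointly `C³` pencil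
  deformations so that `ψ ∈ C²` and the first variation is classical). `Spacetime.RedShiftedCollar`
  (`RedShiftedCollar.lean`) is the same block at the OLDER `C³`/`C²` regularity (grounder note g70-7: "bump
  needed before any by-name restatement"); this is that bump, as a separate name so that nothing stated over
  the old one moves. `redShiftedCollar_of_redShiftedCollarC4`: the new predicate implies the old.

## Design choices

* **Unweighted shell sup, not `shellDeviationCk`.** The seam lemma `truncDeviationCk_le_max` composes
  `supCkENorm` over a union of sets; the scale weights of `shellDeviationCk` (frozen at `ρ₁`) would only
  insert the constants of `supCkENorm_le_shellDeviationCk` / `shellDeviationCk_le_mul_truncDeviationCk`.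
* **`ε = ⊤` quasi decompositions as chart carriers.** `QuasiFinalStateDecomposition 𝓢 𝒟 k ⊤` is exactly
  "the data and the geometric clauses of `FinalStateDecomposition` without its two convergence fields"
  (module docstring of `QuasiFinalStateDecomposition`: at `ε = ⊤` "what remains is the chart geometry");
  `QuasiFinalStateDecomposition.toFinalStateDecomposition` rebuilds a decomposition from convergence IN THE
  SAME CHARTS with `charted` / `certifiedLate` / `certifiedSlab` agreeing by `rfl`, which is what a user of
  `IsLocSettling` who has recovered horizon-uniform convergence needs.
* **Summit bodies inlined verbatim** (`exteriorOf`, `RaysStayInClosure`, `IsOrthochronous`,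
  `IsFutureOriented`, `HasExhaustiveCharts` minus its convergence clause), as `QuasiFinalStateDecomposition`
  already does for `certifiedLate` / `certifiedSlab` / `HasExhaustiveCharts`: Literature may not import
  `Summits`, and the Summit-side user recovers the named clauses by `δ`-unfolding.
* **Anti-vacuity.** `atTop` on `ℝ` is non-trivial; a shell with `ρ₂ < ρ₁` is empty and its deviation `0`
  (intended: closeness on `{r₊ + δ ≤ r ≤ R}` is only asked where the shell is inhabited); for `N = 0` the
  flat domain contains the whole late half-space (`lateRegion_subset_flatDomain_of_N_eq_zero`).

## What is NOT here

Any statement that a development settles (route items), the compactness upgrade "`C³`-bounded collar +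
`C²_loc` convergence ⇒ convergence up to `r₊`" (a route support item), and the bridge
`RedShiftedCollarC4 ↔ Nonempty (witness structure)` (the witness structure of `RedShiftedCollar.lean` is at
the old regularity; not duplicated).

## References

* M. Dafermos, J. Luk, arXiv:1710.01722, §1.2.1 and Conjecture 1 (key `DafermosLuk2017`).
* M. Dafermos, G. Holzegel, I. Rodnianski, M. Taylor, arXiv:2104.08222, §1 (key `arXiv210408222`).
* S. Klainerman, J. Szeftel, *Global nonlinear stability of Schwarzschild spacetime under polarized
  perturbations*, AMS-210 (2020), §1.2 (key `KlainermanSzeftel2020`).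
* M. Dafermos, I. Rodnianski, arXiv:0811.0354, §3.3, §5.1, §7.1 (key `DafermosRodnianski2008` /
  `arXiv08110354`).
* L. Andersson, M. Mars, W. Simon, ATMP 12 (2008), arXiv:0704.2889, Lemma 3.1–3.2, Lemma 4.1, Def./Prop. 5.1
  (key `AnderssonMarsSimon2008`); J. L. Jaramillo, arXiv:1206.1271, Lemma 1 (key `Jaramillo2012`).
-/

noncomputable section

open Set Function Bundle Filter TopologicalSpace
open scoped Manifold ContDiff Topology ENNReal

universe u

namespace Literature.Geometry.Lorentzian

/-! ### A seam lemma for `supCkENorm` -/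

section SupNorm

variable {F G : Type*} [NormedAddCommGroup F] [NormedSpace ℝ F] [NormedAddCommGroup G]
  [NormedSpace ℝ G]

/-- The `Cᵏ` sup norm over a union is at most the larger of the two sup norms (Bartnik 1986, (1.3):
sup norms are monotone in the set). [cite: Bartnik1986, (1.3)] -/
theorem supCkENorm_union_le (S T : Set F) (k : ℕ) (f : F → G) :
    supCkENorm (S ∪ T) k f ≤ max (supCkENorm S k f) (supCkENorm T k f) := by
  refine iSup₂_le fun m hm ↦ iSup₂_le fun x hx ↦ ?_
  rcases hx with hx | hx
  · exact (enorm_iteratedFDeriv_le_supCkENorm hm hx f).trans (le_max_left _ _)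
  · exact (enorm_iteratedFDeriv_le_supCkENorm hm hx f).trans (le_max_right _ _)

end SupNorm

namespace ModelBackground

/-- A truncated slab `{t = τ, r ≤ R}` is covered by the inner truncated slab `{t = τ, r ≤ ρ}` and the
shell `{t = τ, ρ ≤ r ≤ R}` (every `ρ`; `le_total`). DHRT arXiv:2104.08222, §1 (the regions `{r ≤ R}`).
[cite: arXiv210408222, §1] -/
theorem truncTimeSlab_subset_truncTimeSlab_union_shellTimeSlab (B : ModelBackground) (ρ R τ : ℝ) :
    B.truncTimeSlab R τ ⊆ B.truncTimeSlab ρ τ ∪ B.shellTimeSlab ρ R τ := by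
  intro x hx
  rcases le_total (B.radius x.1) ρ with h | h
  · exact Or.inl ⟨hx.1, h⟩
  · exact Or.inr ⟨hx.1, h, hx.2⟩

end ModelBackground

/-! ### The unweighted shell deviation and the seam across a radius -/

namespace Spacetime

variable (𝓢 : Spacetime.{u} 4) (B : ModelBackground)

/-- The **unweighted `Cᵏ` shell deviation** of the chart `Ψ : U → 𝓢` from the reference background `B`:
`sup_{m ≤ k} sup_{t = τ, ρ₁ ≤ r ≤ ρ₂} ‖Dᵐ(Ψ^* g − g_B)‖ ∈ [0, ∞]` — `supCkENorm` of `deviationExtend` over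
the image in `E4` of the chart shell `B.shellTimeSlab ρ₁ ρ₂ τ` (DHRT arXiv:2104.08222, §1: pointwise `Cᵏ`
norms of the metric deviation on `{t* = τ}`, here on the part `{ρ₁ ≤ r ≤ ρ₂}` of the near zone).
[cite: arXiv210408222, §1] -/
def annularDeviationCk (Ψ : B.domain → 𝓢.carrier) (k : ℕ) (ρ₁ ρ₂ τ : ℝ) : ℝ≥0∞ :=
  supCkENorm (Subtype.val '' B.shellTimeSlab ρ₁ ρ₂ τ) k (𝓢.deviationExtend B Ψ)

/-- The shell deviation is dominated by the truncated (near-zone) deviation of the outer radius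
(`shellTimeSlab ⊆ truncTimeSlab`). [cite: arXiv210408222, §1] -/
theorem annularDeviationCk_le_truncDeviationCk (Ψ : B.domain → 𝓢.carrier) (k : ℕ) (ρ₁ ρ₂ τ : ℝ) :
    𝓢.annularDeviationCk B Ψ k ρ₁ ρ₂ τ ≤ 𝓢.truncDeviationCk B Ψ k ρ₂ τ :=
  supCkENorm_mono (image_mono (B.shellTimeSlab_subset_truncTimeSlab ρ₁ ρ₂ τ)) _ _

/-- Convergence on truncated slabs out to (possibly growing) radii `R τ` implies convergence on every shell
inside them (the forgetful direction). [cite: arXiv210408222, §1] -/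
theorem tendsto_annularDeviationCk_of_tendsto_truncDeviationCk (Ψ : B.domain → 𝓢.carrier) (k : ℕ)
    (ρ₁ : ℝ) {R : ℝ → ℝ} (h : Tendsto (fun τ ↦ 𝓢.truncDeviationCk B Ψ k (R τ) τ) atTop (𝓝 0)) :
    Tendsto (fun τ ↦ 𝓢.annularDeviationCk B Ψ k ρ₁ (R τ) τ) atTop (𝓝 0) :=
  tendsto_of_tendsto_of_tendsto_of_le_of_le tendsto_const_nhds h (fun _ ↦ bot_le)
    fun τ ↦ 𝓢.annularDeviationCk_le_truncDeviationCk B Ψ k ρ₁ (R τ) τ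

/-- **Near-zone deviation ≤ max(inner part, outer shell).** For every radius `ρ`, the `Cᵏ` deviation on
`{t = τ, r ≤ R}` is at most the larger of the deviation on `{t = τ, r ≤ ρ}` and the shell deviation on
`{t = τ, ρ ≤ r ≤ R}`. [cite: arXiv210408222, §1] -/
theorem truncDeviationCk_le_max (Ψ : B.domain → 𝓢.carrier) (k : ℕ) (ρ R τ : ℝ) :
    𝓢.truncDeviationCk B Ψ k R τ ≤
      max (𝓢.truncDeviationCk B Ψ k ρ τ) (𝓢.annularDeviationCk B Ψ k ρ R τ) := by
  refine (supCkENorm_mono (image_mono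
    (B.truncTimeSlab_subset_truncTimeSlab_union_shellTimeSlab ρ R τ)) _ _).trans ?_
  rw [image_union]
  exact supCkENorm_union_le _ _ _ _

/-- **Gluing limits across the radius `ρ`.** If the inner part `{r ≤ ρ}` and the shell `{ρ ≤ r ≤ R τ}` of the
near-zone deviation both tend to `0` (radii `R τ` possibly growing), so does the whole near-zone deviation
out to `R τ`. [cite: arXiv210408222, §1] -/
theorem tendsto_truncDeviationCk_of_inner_of_annular (Ψ : B.domain → 𝓢.carrier) (k : ℕ) (ρ : ℝ)
    (R : ℝ → ℝ) (h₁ : Tendsto (fun τ ↦ 𝓢.truncDeviationCk B Ψ k ρ τ) atTop (𝓝 0))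
    (h₂ : Tendsto (fun τ ↦ 𝓢.annularDeviationCk B Ψ k ρ (R τ) τ) atTop (𝓝 0)) :
    Tendsto (fun τ ↦ 𝓢.truncDeviationCk B Ψ k (R τ) τ) atTop (𝓝 0) := by
  have hmax : Tendsto (fun τ ↦ max (𝓢.truncDeviationCk B Ψ k ρ τ) (𝓢.annularDeviationCk B Ψ k ρ (R τ) τ))
      atTop (𝓝 0) := by
    simpa using h₁.max h₂
  exact tendsto_of_tendsto_of_tendsto_of_le_of_le tendsto_const_nhds hmax (fun _ ↦ bot_le)
    fun τ ↦ 𝓢.truncDeviationCk_le_max B Ψ k ρ (R τ) τ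

end Spacetime

/-! ### Clauses on the charts of a quasi decomposition -/

namespace QuasiFinalStateDecomposition

variable {𝓢 : Spacetime.{u} 4} {𝒟 : Set 𝓢.carrier} {k : ℕ} {ε : ℝ≥0∞}

/-- **The charts are future-oriented** — verbatim the body of the Summit-side `IsFutureOriented`
clause of the final-state statement, read in the charts of `q` (with `IsOrthochronous Λ := 0 < (Λ e₀)⁰` unfolded): (i) every asymptotic motion
`Λᵢ` is orthochronous; (ii) for every hole and every truncation radius `ρ`, eventually in chart time, on
`{t*ᵢ = τ, rᵢ ≤ ρ}` the push-forward under `chart i` of `Λᵢ V_{Mᵢ,aᵢ}(Λᵢ⁻¹(x − cᵢ))`, `V = −g♯(dt*)`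
(`Kerr.timeVector`), is future-directed; (iii) eventually, on the flat slab `{x⁰ = τ} ∩ U₀` the
push-forward of `∂₀` under the flat chart is future-directed. Dafermos–Rodnianski arXiv:0811.0354, §5.1;
O'Neill 1983, Ch. 9, pp. 233–236. [cite: arXiv08110354, §5.1] -/
def IsFutureOrientedCharts (q : QuasiFinalStateDecomposition 𝓢 𝒟 k ε) : Prop :=
  (∀ i, 0 < ((q.motion i).1 : E4 ≃L[ℝ] E4) (E4.basisVector 0) 0) ∧
  (∀ i (ρ : ℝ), ∀ᶠ τ in atTop, ∀ x ∈ (q.background i).truncTimeSlab ρ τ,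
    𝓢.timeOrientation.IsFutureDirected
      (mfderiv 𝓘(ℝ, E4) (𝓡 4) (q.chart i) x
        (((q.motion i).1 : E4 ≃L[ℝ] E4)
          (Kerr.timeVector (q.mass i) (q.spin i)
            (poincareInv (q.motion i).1 (q.motion i).2 (x : E4)))))) ∧
  ∀ᶠ τ in atTop, ∀ x ∈ (Minkowski.backgroundOn q.flatDomain).timeSlab τ,
    𝓢.timeOrientation.IsFutureDirected
      (mfderiv 𝓘(ℝ, E4) (𝓡 4) q.flatChart x (E4.basisVector 0))

/-- **The charts exhaust the region, horizon-excised form**: the body of the Summit-side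
`HasExhaustiveCharts` — honest growing near-zone radii `Rᵢ(τ) ≥ max(r₊(Mᵢ,aᵢ), 0) + 1`, `Rᵢ → ∞`, and for
every chart time `τ₁ > τ₀` the causal covering of `𝒟` outside the certified late region after `τ₁` by the
certified slab at `τ₁` — with the growing-radii CONVERGENCE clause asked only away from the horizon: for every
`δ > 0` the `Cᵏ` shell deviation on `{t*ᵢ = τ, r₊ᵢ + δ ≤ rᵢ ≤ Rᵢ(τ)}` tends to `0`. Dafermos–Luk
arXiv:1710.01722, §1.2.1, items (b)–(c) of the displayed Kerr-stability statement. [cite: DafermosLuk2017, §1.2.1 (b)–(c)] -/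
def HasLocExhaustiveCharts (q : QuasiFinalStateDecomposition 𝓢 𝒟 k ε) : Prop :=
  ∃ R : Fin q.N → ℝ → ℝ,
    (∀ i, Tendsto (R i) atTop atTop ∧ ∀ τ, max (Kerr.rPlus (q.mass i) (q.spin i)) 0 + 1 ≤ R i τ) ∧
    (∀ i (δ : ℝ), 0 < δ → Tendsto (fun τ ↦ 𝓢.annularDeviationCk (q.background i) (q.chart i) k
      (Kerr.rPlus (q.mass i) (q.spin i) + δ) (R i τ) τ) atTop (𝓝 0)) ∧
    ∀ τ₁ : ℝ, q.τ₀ < τ₁ →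
      𝒟 \ q.certifiedLate R τ₁ ⊆ 𝓢.metric.causalPast 𝓢.timeOrientation (q.certifiedSlab R τ₁)

end QuasiFinalStateDecomposition

/-! ### Settling in `C²_loc`, for one Cauchy development -/

namespace CauchyDevelopment

variable {X : Type} [TopologicalSpace X] [ChartedSpace E3 X] [IsManifold (𝓡 3) ∞ X]
  [ConnectedSpace X] {D : InitialDataSet (𝓡 3) X}

/-- **Settles down in `C²_loc`** (one Cauchy development `𝒟 = (M, g, τ, ι, ν)`, region `O`, chart system
`q`): the settled clause of the final-state statement (Dafermos–Luk arXiv:1710.01722, §1.2.1) with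
near-zone convergence asserted only on COMPACTA of the open Kerr exteriors.
`q : QuasiFinalStateDecomposition 𝒟.toSpacetime O 2 ⊤` carries the chart geometry (finitely many boosted
Kerr exteriors `|aᵢ| ≤ Mᵢ`, late charts into `O`, separation, sublinear excision, flat chart, covering),
and: (i) for every hole `i`, `δ > 0`, `R`, the `C²` shell deviation of `(chart i)^* g` from boosted Kerr on
`{t*ᵢ = τ, r₊ᵢ + δ ≤ rᵢ ≤ R}` tends to `0`; (ii) the `C²` deviation of the flat chart from `η` on the flat
slabs tends to `0`; (iii) `O = J⁺(ι X) ∩ I⁻(q.charted)` (verbatim the body of the Summit-side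
`exteriorOf`); (iv) every future-complete normalised null ray from the data stays in `closure O`
(verbatim the body of the Summit-side `RaysStayInClosure`); (v) the
charts exhaust `O` in the excised sense (`HasLocExhaustiveCharts`); (vi) chart times are future-oriented
(`IsFutureOrientedCharts`). Nothing is asserted at or across the horizons (no rate, no uniformity in `δ`).
[cite: DafermosLuk2017, §1.2.1] -/
def IsLocSettling (𝒟 : CauchyDevelopment D) (O : Set 𝒟.carrier)
    (q : QuasiFinalStateDecomposition 𝒟.toSpacetime O 2 ⊤) : Prop :=
  (∀ i (δ R : ℝ), 0 < δ → Tendsto (fun τ ↦ 𝒟.toSpacetime.annularDeviationCk (q.background i)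
    (q.chart i) 2 (Kerr.rPlus (q.mass i) (q.spin i) + δ) R τ) atTop (𝓝 0)) ∧
  Tendsto (fun τ ↦ 𝒟.toSpacetime.deviationCk (Minkowski.backgroundOn q.flatDomain) q.flatChart 2 τ)
    atTop (𝓝 0) ∧
  O = 𝒟.metric.causalFuture 𝒟.timeOrientation (range 𝒟.embed) ∩
        𝒟.metric.chronologicalPast 𝒟.timeOrientation q.charted ∧
  (∀ [𝒟.metric.HasLeviCivita], ∀ (p : X) (γ : ℝ → 𝒟.carrier) (dom : Set ℝ),
    𝒟.metric.IsNormalisedNullRayFrom 𝒟.timeOrientation 𝒟.embed 𝒟.normal p γ dom →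
      ¬ BddAbove dom → ∀ t ∈ dom, 0 ≤ t → γ t ∈ closure O) ∧
  q.HasLocExhaustiveCharts ∧ q.IsFutureOrientedCharts

/-- The forgetful direction (sanity of the typing): a `C²` final-state decomposition `d` of `O` with the
final-state statement's clauses — `O = J⁺(ιX) ∩ I⁻(d.charted)`, rays in `closure O`, exhaustive charts
with honest radii, future-oriented charts (the Summit clauses, stated here through their bodies) — is a
`C²_loc` settling in its own charts (`FinalStateDecomposition.toQuasi` at `ε = ⊤`; shells are dominated by
truncated slabs). [cite: DafermosLuk2017, §1.2.1] -/
theorem isLocSettling_toQuasi (𝒟 : CauchyDevelopment D) {O : Set 𝒟.carrier}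
    (d : FinalStateDecomposition 𝒟.toSpacetime O 2)
    (hO : O = 𝒟.metric.causalFuture 𝒟.timeOrientation (range 𝒟.embed) ∩
        𝒟.metric.chronologicalPast 𝒟.timeOrientation d.charted)
    (hrays : ∀ [𝒟.metric.HasLeviCivita], ∀ (p : X) (γ : ℝ → 𝒟.carrier) (dom : Set ℝ),
      𝒟.metric.IsNormalisedNullRayFrom 𝒟.timeOrientation 𝒟.embed 𝒟.normal p γ dom →
        ¬ BddAbove dom → ∀ t ∈ dom, 0 ≤ t → γ t ∈ closure O)
    (hexh : ∃ R : Fin d.N → ℝ → ℝ,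
      (∀ i, Tendsto (R i) atTop atTop ∧ ∀ τ, max (Kerr.rPlus (d.mass i) (d.spin i)) 0 + 1 ≤ R i τ) ∧
      (∀ i, Tendsto (fun τ ↦ 𝒟.toSpacetime.truncDeviationCk (d.background i) (d.chart i) 2 (R i τ) τ)
        atTop (𝓝 0)) ∧
      ∀ τ₁ : ℝ, d.τ₀ < τ₁ →
        O \ (d.flatChart '' (Minkowski.backgroundOn d.flatDomain).lateRegion τ₁ ∪
            ⋃ i, d.chart i '' {x | τ₁ < (d.background i).time x.1 ∧
              (d.background i).radius x.1 ≤ R i ((d.background i).time x.1)}) ⊆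
          𝒟.metric.causalPast 𝒟.timeOrientation
            (d.flatChart '' (Minkowski.backgroundOn d.flatDomain).timeSlab τ₁ ∪
              ⋃ i, d.chart i '' (d.background i).truncTimeSlab (R i τ₁) τ₁))
    (hfo : (∀ i, 0 < ((d.motion i).1 : E4 ≃L[ℝ] E4) (E4.basisVector 0) 0) ∧
      (∀ i (ρ : ℝ), ∀ᶠ τ in atTop, ∀ x ∈ (d.background i).truncTimeSlab ρ τ,
        𝒟.timeOrientation.IsFutureDirected
          (mfderiv 𝓘(ℝ, E4) (𝓡 4) (d.chart i) x
            (((d.motion i).1 : E4 ≃L[ℝ] E4)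
              (Kerr.timeVector (d.mass i) (d.spin i)
                (poincareInv (d.motion i).1 (d.motion i).2 (x : E4)))))) ∧
      ∀ᶠ τ in atTop, ∀ x ∈ (Minkowski.backgroundOn d.flatDomain).timeSlab τ,
        𝒟.timeOrientation.IsFutureDirected
          (mfderiv 𝓘(ℝ, E4) (𝓡 4) d.flatChart x (E4.basisVector 0))) :
    𝒟.IsLocSettling O (d.toQuasi (ε := ⊤) (by simp)) := by
  refine ⟨fun i δ R _ ↦ ?_, d.tendsto_deviationCk_flat, hO, hrays, ?_, hfo⟩
  · exact 𝒟.toSpacetime.tendsto_annularDeviationCk_of_tendsto_truncDeviationCk _ _ 2 _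
      (R := fun _ ↦ R) (d.tendsto_truncDeviationCk i R)
  · obtain ⟨R, hR, hconv, hcov⟩ := hexh
    exact ⟨R, hR, fun i δ _ ↦
      𝒟.toSpacetime.tendsto_annularDeviationCk_of_tendsto_truncDeviationCk _ _ 2 _ (hconv i), hcov⟩

end CauchyDevelopment

/-! ### The red-shifted collar at the items' current regularity -/

namespace Spacetime

variable (𝓢 : Spacetime.{u} 4)

/-- **Red-shifted collar of a hole chart, `C⁴`/`C³` regularity**: VERBATIM the `let`-bound block `RSC` at
the head of the route items `HorizonSubextremal` (item 17367) and `GenericRedShiftedSettling` (item 17368)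
of route `SpectralSurfaceGravity` of the final-state summit (rev 4), so that `RSC 𝓢 Λ c M a τ₀ chart` and `𝓢.RedShiftedCollarC4 Λ c M a τ₀ chart` agree by
`δ/ζ`-unfolding. Same fifteen clauses as `Spacetime.RedShiftedCollar` (see there for the clause-by-clause
reading) with two regularity exponents raised by the refuter repair of 2026-08-15: the collar chart `Φ` is
`C⁴` on `C` (was `C³`) and the pencil deformation `F` is jointly `C³` in `(s, n)` (was `C²`), so that the
supersolution `ψ` is `C²` and `d/ds θ_ℓ` is the classical first variation (Andersson–Mars–Simon 2008, Lemma
3.1–3.2; with `C²` families the calibration item's `→` half was false). A posited object of the route: no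
printed source defines this predicate as a whole; its ingredients are Andersson–Mars–Simon 2008, Lemma 3.1,
Def. 3.1, Lemma 3.2, Lemma 4.1, Def. 5.1 / Prop. 5.1 (stability operator, principal eigenvalue, positive
supersolutions), Jaramillo 2012, Lemma 1 (surface gravity of isolated horizons as the pencil eigenvalue) and
the collar geometry of Dafermos–Rodnianski 2008, §7.1, Thm. 7.1.
[cite: AnderssonMarsSimon2008, Lemma 3.1, Def. 3.1, Lemma 3.2, Def. 5.1] -/
def RedShiftedCollarC4 (Λ : lorentzGroup) (c : E4) (M a τ₀ : ℝ)
    (chart : boostedKerrExterior Λ c M a → 𝓢.carrier) : Prop :=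
  let S2 := Metric.sphere (0 : E3) 1; ∃ (η κ m b B τ₁ : ℝ) (Φ : E4 → 𝓢.carrier) (ρ : ℝ → E3 → ℝ), 0 < η ∧ 0 < κ ∧ 0 < m ∧ 0 < b ∧ let r := Literature.Geometry.Lorentzian.Kerr.radius a; let C : Set E4 := {z | τ₀ < z 0 ∧ |r z - Literature.Geometry.Lorentzian.Kerr.rPlus M a| < η}; let gC : E4 → E4 →L[ℝ] E4 →L[ℝ] ℝ := fun z ↦ Literature.Geometry.Lorentzian.pullbackBilin (I := 𝓡 4) (I' := 𝓘(ℝ, E4)) Φ 𝓢.metric.val z; let sec : ℝ → S2 → E4 := fun τ n ↦ Literature.Geometry.Lorentzian.E4.ofTimeSpace τ (ρ τ n • (n : E3)); let A := Ioi τ₁ ×ˢ {y : E3 | 2⁻¹ < ‖y‖ ∧ ‖y‖ < 2}; let T := (fun q : ℝ × S2 ↦ Φ (sec q.1 q.2)) '' (Ioi τ₁ ×ˢ univ); ContMDiffOn 𝓘(ℝ, E4) (𝓡 4) 4 Φ C ∧ Topology.IsOpenEmbedding (C.restrict Φ) ∧ EqOn chart (Φ ∘ Literature.Geometry.Lorentzian.poincareInv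 Λ c ∘ Subtype.val) {x | Literature.Geometry.Lorentzian.poincareInv Λ c x ∈ C} ∧ Literature.Geometry.Lorentzian.supCkENorm {z ∈ C | τ₁ ≤ z 0} 3 gC ≤ ENNReal.ofReal B ∧ (∀ z ∈ C, τ₁ ≤ z 0 → (∀ v : E4, v 0 = 0 → b * ‖v‖ ^ 2 ≤ gC z v v) ∧ ∃ w : E4, ‖w‖ ≤ 1 ∧ gC z w w ≤ -b) ∧ ContDiffOn ℝ 4 (uncurry ρ) A ∧ Literature.Geometry.Lorentzian.supCkENorm A 4 (uncurry ρ) ≤ ENNReal.ofReal B ∧ (∀ τ, τ₁ < τ → ∀ n : S2, sec τ n ∈ C) ∧ (∀ ε > (0 : ℝ), ∃ τ₂ : ℝ, ∀ τ, τ₂ < τ → ∀ n : S2, Literature.Geometry.Lorentzian.Kerr.rPlus M a - ε < r (sec τ n)) ∧ (∀ p ∈ T, ∀ q ∈ T, q ∉ 𝓢.metric.chronologicalFuture 𝓢.timeOrientation {p}) ∧ (∀ τ, τ₁ < τ → ∀ [𝓢.metric.HasLeviCivita], ∀ hpb, ∃ (ψ : S2 → ℝ) (F : ℝ → S2 → 𝓢.carrier)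 (P : ∀ s, Literature.Geometry.Lorentzian.LorentzianMetric.NullNormalPair (𝓡 2) 𝓢.metric 𝓢.timeOrientation (F s)) (hF : ∀ s, 𝓢.metric.IsSpacelikeImmersion (𝓡 2) (F s)), (F 0 = fun n ↦ Φ (sec τ n)) ∧ ContMDiff (𝓘(ℝ, ℝ).prod (𝓡 2)) (𝓡 4) 3 (uncurry F) ∧ ContMDiff (𝓘(ℝ, ℝ).prod (𝓡 2)) (𝓡 4).tangent 0 (fun p : ℝ × S2 ↦ (Bundle.TotalSpace.mk' E4 (F p.1 p.2) ((P p.1).L p.2) : TangentBundle (𝓡 4) 𝓢.carrier)) ∧ 𝓢.metric.IsMarginallyTrapped hpb (hF 0) (P 0) ∧ (∀ n, m ≤ ψ n ∧ ψ n ≤ 1) ∧ (∀ n, ∃ v : E4, v 0 = 1 ∧ mfderiv 𝓘(ℝ, E4) (𝓡 4) Φ (sec τ n) v = (P 0).L n) ∧ (∀ n, mfderiv 𝓘(ℝ, ℝ) (𝓡 4) (fun s ↦ F s n) 0 1 = (-(ψ n)) • (P 0).Lbar n) ∧ (∀ n, ∃ D : ℝ, HasDerivAt (fun s ↦ 𝓢.metric.nullExpansion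 (F s) hpb (hF s) (P s).L n) D 0 ∧ κ * (-(𝓢.metric.nullExpansion (F 0) hpb (hF 0) (P 0).Lbar n)) * ψ n ≤ D))

/-- The `C⁴`/`C³` collar is in particular a collar at the older `C³`/`C²` regularity
(`ContMDiffOn.of_le`, `ContMDiff.of_le`; all other clauses verbatim). [folklore] -/
theorem redShiftedCollar_of_redShiftedCollarC4 {Λ : lorentzGroup} {c : E4} {M a τ₀ : ℝ}
    {chart : boostedKerrExterior Λ c M a → 𝓢.carrier} (h : 𝓢.RedShiftedCollarC4 Λ c M a τ₀ chart) :
    𝓢.RedShiftedCollar Λ c M a τ₀ chart := by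
  obtain ⟨η, κ, m, b, B, τ₁, Φ, ρ, hη, hκ, hm, hb, h⟩ := h
  obtain ⟨h1, h2, h3, h4, h5, h6, h7, h8, h9, h10, h11⟩ := h
  refine ⟨η, κ, m, b, B, τ₁, Φ, ρ, hη, hκ, hm, hb, h1.of_le (by norm_num), h2, h3, h4, h5, h6, h7, h8, h9,
    h10, fun τ hτ _ hpb ↦ ?_⟩
  obtain ⟨ψ, F, P, hF, hF0, hF3, hL, hmt, hψ, hclock, hvel, hpencil⟩ := h11 τ hτ hpb
  exact ⟨ψ, F, P, hF, hF0, hF3.of_le (by norm_num), hL, hmt, hψ, hclock, hvel, hpencil⟩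

end Spacetime

end Literature.Geometry.Lorentzian

end
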